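import Summits.BirchSwinnertonDyer.Rank1Residual.X11b.Three.KolyvaginClassMultiplicativePlace
import Summits.BirchSwinnertonDyer.Rank1Residual.X11b.Three.UnramifiedClassCusp
import Summits.BirchSwinnertonDyer.Rank1Residual.X11b.NeronIdentityReceptacle
import Literature.NumberTheory.EllipticCurves.HeegnerPointsKolyvaginPrimaryPointsProofs
import HarnessLib

/-!
# X11b (team N8/O2), S15 (vi): leaf (A) of the Kolyvagin finiteness chain FROM POINTS with its local
# clause `hloc` (McCallum Lemma 4.3 / Gross Prop. 6.2 (1) at every `v ∤ m`) DISCHARGED from the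
# cite-only [GZ86, III (3.1)] receptacle shape

HONEST FRAMING (cell `b2b-bsdres`, run/shared/lean/b2b/bsd-rank1-residual/, verbatim in every
file): the goal of the cell is to DELETE the COMBINATION-SHAPED residual classes of the
Birch–Swinnerton-Dyer formula for ALL analytic-rank `≤ 1` elliptic curves over `ℚ` — "full BSD
formula for every rank `≤ 1` curve in class `C`" assembled STRICTLY from published theorems — so
that the rank-`≤ 1` remainder becomes exactly the CONSTRUCTION-SHAPED classes, which are TYPED
(missing-input `Prop`s), NOT attempted. This is not "finishing BSD". Team N8/O2 = `x11b3`, seat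
`b2b-bsdres-x11b3-p2` (GEN 3), LEAD DEAL #7 R7-51 (S15 (vi)). THEOREMS ONLY: no definition, no
named fact, no `sorry`; nothing is booked; the Literature descent file and the named fact
`Kolyvagin1990_sha_primary_finite` are UNTOUCHED (this is a Summits-side corollary FEEDING the
`hpoints` hypothesis of `KolyvaginDescent.Kolyvagin1990_sha_primary_finite_of_pointsM_of_thmA`).
The flag `JET@p|N` is NOT discharged.

## What

The tree's `KolyvaginDescent.exists_leafA_of_points` (`HeegnerPointsKolyvaginPrimaryPointsProofs`)
builds leaf (A) of Kolyvagin's descent — the classes `c_M(m)`, `c_M(1) = δ_M y_K`, their signs —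
from points `P_m ∈ A_m ⊆ E(K̄)`, carrying as the hypothesis **`hloc`** McCallum 1991 Lemma 4.3
(first part) = Gross 1991 Prop. 6.2 (1): "`c_M(m)_v ∈ δ(E(K_v))` for every `v ∤ m`". The tree
proves that clause only at places of GOOD reduction (`kolyvaginClass_mem_selmerLocalKer_of_inertia`,
Milne *ADT* I.3.8). With S15 — x11b3-p8's `UnramifiedNode.kolyvaginClass_kolyvaginPoint_mem_selmerLocalKer_of_GZ31_of_has{Multiplicative,Additive}ReductionAt`
(Milne I.3.8 for `E⁰` at a node / a cusp) on top of x11b3-p1's END FORM (Gross p. 245: [GZ86,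
III (3.1)] + integrality of Kolyvagin's roots) — the clause holds at EVERY finite `v ∤ m` for
`P_m := j_m(Σ_{s∈S} s D_m y_m)` (the tree's `KolyvaginEuler.kolyvaginPoint`), `A_m := j_m(E(K_m))`:

* `exists_leafA_of_points_of_GZ31_of_receptacle` — **leaf (A) from points WITHOUT `hloc`**: the
  conclusion of `exists_leafA_of_points` verbatim, its hypotheses verbatim EXCEPT that `A`, `Pt` are
  Kolyvagin's (`A m = (j m).range`, `Pt m = j m (kolyvaginPoint (σ m) (L m) (f m) (y m))` for the
  Euler-system data `𝒢_m ↷ E(K_m)`, `σ`, `L`, `H = G_m`, `f`, `y_m`, `π_m : Γ_K → 𝒢_m`,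
  `j_m : E(K_m) → E(K̄)` equivariant — Gross §§3–4, the tree's `KolyvaginEuler` dictionary) and
  `hloc` is REPLACED by: `hI` (the inertia groups at `v ∤ m` fix `j_m P_m`: "`K_m/K` is unramified
  outside `m`"), the Euler identities `hf`/`hgen`/`hord`/`hdvd`, and **`hGZ31`** — for every `m` a
  `𝒢_m`-stable `E′_m ∋ y_m` with `Tr_ℓ y_m ∈ p^M E′_m` (`ℓ ∈ L m`) whose image at every BAD place
  `v` is killed by `n′` (prime to `p`) into a receptacle `B_v ⊆ E⁰(K̄_v)` — the PUBLISHED input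
  [GZ86, III (3.1)] ("`y_m ∈ E⁰ + E(ℚ)_tors` at every `w ∣ N`", `n′ = #E(ℚ)_tors`) in the shape
  Gross 1991 p. 245 uses it, cite-only. The receptacles are given here PARAMETRICALLY (x11b3-p8's
  design): per place the tree witnesses `w_v`/`ι_v`/`C_v` and `B_v` with `hB_v : B_v ⊆ E⁰`; the
  named form `B_v := X11b.E0Receptacle (W.baseChange K) v` follows in a corollary once
  `X11b/NeronIdentityReceptacle` (review-queued) lands.

* (SECOND CUT, appended) the NAMED receptacle `E⁰(K̄_v) = X11b.E0Receptacle X v`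
  (`X11b/NeronIdentityReceptacle`, ONE reviewed def, LEAD R7-51 (R-b)) instead of the five binders
  `w hw ι hι C hC B hB` per place: `oneCocycleClass_eq_zero_of_mem_E0Receptacle` (x11b3-p8's
  `UnramifiedNode.oneCocycleClass_eq_zero_of_has{Multiplicative,Additive}ReductionAt` and the tree's Milne
  leaf, by the trichotomy — `hvanish` for `B = E⁰(K̄_v)` at EVERY finite place, `hB` read through
  `X11b.mem_E0Receptacle_iff`),
  `kolyvaginClass_kolyvaginPoint_mem_selmerLocalKer_of_GZ31_E0` (Gross Prop. 6.2 (1) for `P_n` at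
  EVERY finite `v ∤ n`, receptacle `E⁰(K̄_v)`, no witness binder) and
  **`exists_leafA_of_points_of_GZ31`** — leaf (A) from Kolyvagin's points WITHOUT `hloc`, the
  [GZ86, III (3.1)] clause stated against `E⁰(K̄_v)` by name: per `m`, "`n′ • (j_m x)_v ∈ E⁰(K̄_v)`
  for `x ∈ E′_m` at every place of bad reduction".

Proof: `exists_leafA_of_points` with `hloc` supplied place by place by the tree trichotomy
(Silverman *AEC* VII.5.1): good `v` → the tree's Milne leaf
(`GrossBadPlace.kolyvaginClass_mem_selmerLocalKer_of_inertia_of_hasGoodReductionAt`, no receptacle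
clause); multiplicative / additive `v` → x11b3-p8's corollaries with `hGZ31`'s clause at `v`.

References (locators only; no cited FACT): [cite: GrossLMS1991, §3 Prop. 3.6–3.7, §4 (4.1), Lemma 4.3,
Prop. 6.2 (1) pp. 244–245] [cite: McCallumLMS1991, §4 (4)–(6), Lemma 4.1, Lemma 4.3]
[cite: GrossZagier1986, III (3.1)] [cite: MilneADT2006, Ch. I Prop. 3.8]
[cite: SilvermanAEC2009, VII.5 Prop. 5.1]; cell files p253373 / p253535 / p254200 (x11b3-p1),
p257318 / p259017 (x11b3-p8), p258293 / p259344 (x11b3-p2).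

## Design

No definitions; `noncomputable section`; `open scoped Classical NNReal`; families indexed by the
level `m : ℕ` (`𝒢 m`, `A₀ m`, …) and by the place `v` (witnesses and receptacles). Namespace
`Summit.BirchSwinnertonDyer.Rank1Residual.X11b.Three.GrossBadPlace`. Axioms: `propext`,
`Classical.choice`, `Quot.sound`.
-/

noncomputable section

open scoped Classical NNReal
open scoped AddSubgroup

namespace Summit.BirchSwinnertonDyer.Rank1Residual.X11b.Three.GrossBadPlace

open WeierstrassCurve NumberField IsDedekindDomain Field
  Literature.NumberTheory.EllipticCurves Literature.NumberTheory.EllipticCurves.KolyvaginCocycle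
  Literature.NumberTheory.EllipticCurves.KolyvaginEuler
  Literature.NumberTheory.EllipticCurves.KolyvaginDescent
  Literature.NumberTheory.GaloisRepresentations
  Summit.BirchSwinnertonDyer.Rank1Residual.X11b.Three.UnramifiedNode
  Summit.BirchSwinnertonDyer.Rank1Residual.X11b IsDedekindDomain.HeightOneSpectrum

universe u

variable {N : ℕ} {W : WeierstrassCurve ℚ} [W.IsElliptic] {K : Type u} [Field K]
  [NumberField K]

/-- **Leaf (A) of Kolyvagin's descent from points, with McCallum's Lemma 4.3 / Gross's Prop. 6.2 (1)
DISCHARGED at every `v ∤ m` (parametric receptacles).** Setting of the tree's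
`KolyvaginDescent.exists_leafA_of_points` (`p`, `M`, `hdiv`, the complex conjugation `c` with lift
`τ`, the sign `ε`) with Kolyvagin's own points: for every level `m`, `𝒢 m = Gal(K_m/K)` acting on
`A₀ m = E(K_m)`, `σ m ℓ` generating `G_ℓ`, `L m` the primes of `m`, `H m = G_m` with section `f m`,
the Heegner point `y m`, `π m : Γ_K → 𝒢 m` and `j m : E(K_m) → E(K̄)` additive, injective-range
admissible (`hA`, Gross Lemma 4.3) and equivariant (`hj`), `P_m = kolyvaginPoint (σ m) (L m) (f m) (y m)`
with `j_m P_m ∈ invPoints` (`hPt`, McCallum (4) = `KolyvaginEuler.smul_kolyvaginPoint_sub_mem`).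
Hypotheses kept verbatim from the tree's leaf: `hAτ`, `hPt1` (`j_1 P_1 = y_K`), `h541` (Prop. 5.4
(1)), `h44` (McCallum Prop. 4.4). Hypothesis `hloc` REPLACED by: `hI` (inertia at every `v ∤ m`
fixes `j_m P_m`), the Euler identities `hf`/`hgen`/`hord`/`hdvd`, per-place tree witnesses
`w`/`ι`/`C` with receptacles `B v ⊆ E⁰(K̄_v)` (`hB`), and **`hGZ31`** ([GZ86, III (3.1)] via Gross
1991 p. 245, cite-only): `E′_m ∋ y_m` `𝒢_m`-stable with `Tr_ℓ y_m ∈ p^M E′_m` and, at every place of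
BAD reduction, `n′ • (j_m x)_v ∈ B v` for `x ∈ E′_m`, `n′` prime to `p^M`. Conclusion: that of
`exists_leafA_of_points` (the classes `c_M(m)` with `c_M(1) = δ_M y_K`, their signs, the Selmer
condition at every `v ∤ m`, and `h44` re-exported). [cite: GrossLMS1991, Prop. 6.2 (1), pp. 244–245,
Lemma 4.3, §4 (4.1)] [cite: McCallumLMS1991, Lemma 4.3, Prop. 4.4] [cite: GrossZagier1986, III (3.1)]
[cite: MilneADT2006, Ch. I Prop. 3.8] [cite: SilvermanAEC2009, VII.5 Prop. 5.1] -/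
theorem exists_leafA_of_points_of_GZ31_of_receptacle {P : (W.baseChange K).toAffine.Point}
    {p M : ℕ} (hdiv : ∀ Q : geomPoints (W.baseChange K), ∃ R, ((p ^ M : ℕ) : ℤ) • R = Q)
    (c : K ≃ₐ[ℚ] K) {τ : AlgebraicClosure K ≃+* AlgebraicClosure K} (hτ : IsLiftOfAut c τ)
    (ε : ℤ)
    -- Kolyvagin's Euler-system data, level by level (Gross §§3–4; the tree's `KolyvaginEuler`)
    {𝒢 : ℕ → Type*} [∀ m, CommGroup (𝒢 m)] {A₀ : ℕ → Type*} [∀ m, AddCommGroup (A₀ m)]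
    [∀ m, DistribMulAction (𝒢 m) (A₀ m)]
    (σ : ∀ m, ℕ → 𝒢 m) (L : ℕ → Finset ℕ) (H : ∀ m, Subgroup (𝒢 m))
    [∀ m, Fintype (𝒢 m ⧸ H m)] (f : ∀ m, 𝒢 m ⧸ H m → 𝒢 m)
    (hf : ∀ m q, (f m q : 𝒢 m ⧸ H m) = q)
    (hgen : ∀ m, H m ≤ Subgroup.closure (σ m '' (L m : Set ℕ)))
    (hord : ∀ m, ∀ ℓ ∈ L m, σ m ℓ ^ (ℓ + 1) = 1)
    (hdvd : ∀ m, ∀ ℓ ∈ L m, ((p ^ M : ℕ) : ℤ) ∣ ((ℓ + 1 : ℕ) : ℤ))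
    (y : ∀ m, A₀ m)
    (π : ∀ m, absoluteGaloisGroup K →* 𝒢 m) (j : ∀ m, A₀ m →+ geomPoints (W.baseChange K))
    (hj : ∀ m (g : absoluteGaloisGroup K) (a : A₀ m), j m (π m g • a) = g • j m a)
    (hA : ∀ m, IsAdmissible (absoluteGaloisGroup K) (j m).range ((p ^ M : ℕ) : ℤ))
    (hPt : ∀ m, j m (kolyvaginPoint (σ m) (L m) (f m) (y m)) ∈
      invPoints (absoluteGaloisGroup K) (j m).range ((p ^ M : ℕ) : ℤ))
    -- the tree leaf's remaining hypotheses, verbatim for these `A`, `Pt`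
    (hAτ : ∀ m, ∀ a ∈ (j m).range, hτ.pointsMap W a ∈ (j m).range)
    (hPt1 : j 1 (kolyvaginPoint (σ 1) (L 1) (f 1) (y 1)) = toGeomPoints (W.baseChange K) P)
    (h541 : ∀ m : ℕ, Squarefree m →
      (∀ q ∈ m.primeFactors, IsKolyvaginPrime N W K p q ∧ FrobEqFrobInfty W K (p ^ M) q) →
      ∃ B ∈ (j m).range, hτ.pointsMap W (j m (kolyvaginPoint (σ m) (L m) (f m) (y m))) =
        (ε * (-1) ^ m.primeFactors.card) • j m (kolyvaginPoint (σ m) (L m) (f m) (y m)) +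
          ((p ^ M : ℕ) : ℤ) • B)
    (h44 : ∀ m : ℕ, Squarefree m →
      (∀ q ∈ m.primeFactors, IsKolyvaginPrime N W K p q ∧ FrobEqFrobInfty W K (p ^ M) q) →
      ∀ ℓ : ℕ, ℓ.Prime → ℓ ∣ m → ∀ v : HeightOneSpectrum (𝓞 K), (ℓ : 𝓞 K) ∈ v.asIdeal →
        ∀ a : ℕ, (((p : ℤ) ^ a) • kolyvaginClass (W.baseChange K) _ hdiv (hA m)
              (j m (kolyvaginPoint (σ m) (L m) (f m) (y m))) (hPt m) ∈
            selmerLocalKer (W.baseChange K) (v.adicCompletion K) ((p ^ M : ℕ) : ℤ) ↔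
          ((p : ℤ) ^ a) • kolyvaginClass (W.baseChange K) _ hdiv (hA (m / ℓ))
              (j (m / ℓ) (kolyvaginPoint (σ (m / ℓ)) (L (m / ℓ)) (f (m / ℓ)) (y (m / ℓ))))
              (hPt (m / ℓ)) ∈
            (W.baseChange K).torsionLocalKer (v.adicCompletion K) ((p ^ M : ℕ) : ℤ)))
    -- what REPLACES `hloc`: inertia, the tree witnesses + receptacles, and [GZ86, III (3.1)]
    (hI : ∀ m : ℕ, ∀ v : HeightOneSpectrum (𝓞 K), (m : 𝓞 K) ∉ v.asIdeal →
      ∀ 𝔐 ∈ v.localPrimesAbove, ∀ t ∈ 𝔐.inertia (absoluteGaloisGroup (v.adicCompletion K)),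
        resGal (K := K) (v.adicCompletion K) t • j m (kolyvaginPoint (σ m) (L m) (f m) (y m)) =
          j m (kolyvaginPoint (σ m) (L m) (f m) (y m)))
    (w : ∀ v : HeightOneSpectrum (𝓞 K), Valuation (AlgebraicClosure (v.adicCompletion K)) ℝ≥0)
    (hw : ∀ v x, (w v x : ℝ) =
      spectralNorm (v.adicCompletion K) (AlgebraicClosure (v.adicCompletion K)) x)
    (ι : ∀ v : HeightOneSpectrum (𝓞 K), v.adicCompletionIntegers K →+* (w v).integer)
    (hι : ∀ v a, ((ι v a : (w v).integer) : AlgebraicClosure (v.adicCompletion K)) =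
      algebraMap (v.adicCompletion K) (AlgebraicClosure (v.adicCompletion K))
        (a : v.adicCompletion K))
    (C : ∀ v : HeightOneSpectrum (𝓞 K), VariableChange (v.adicCompletion K))
    (hC : ∀ v, C v • (W.baseChange K).baseChange (v.adicCompletion K) =
      ((W.baseChange K).localMinimalIntegralModel v).map
        (algebraMap (v.adicCompletionIntegers K) (v.adicCompletion K)))
    (B : ∀ v : HeightOneSpectrum (𝓞 K), AddSubgroup (localPoints (W.baseChange K) (v.adicCompletion K)))
    (hB : ∀ v, ∀ Q ∈ B v, (((W.baseChange K).localMinimalIntegralModel v).map (ι v)).HasNonsingularReduction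
      (Affine.Point.congrEquiv (baseChange_map_eq_baseChange_map (hι v)
          ((W.baseChange K).localMinimalIntegralModel v))
        (Affine.Point.congrEquiv (congrArg (fun X : WeierstrassCurve (v.adicCompletion K) ↦
            X.baseChange (AlgebraicClosure (v.adicCompletion K))) (hC v))
          (VariableChange.pointEquivBaseChange ((W.baseChange K).baseChange (v.adicCompletion K)) (C v)
            (AlgebraicClosure (v.adicCompletion K))
            (Affine.Point.congrEquiv (baseChange_baseChange_adicCompletion (W.baseChange K) v).symm Q)))))
    (E' : ∀ m, AddSubgroup (A₀ m)) {n' : ℤ} (hcop : IsCoprime ((p ^ M : ℕ) : ℤ) n')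
    (hGZ31 : ∀ m, (∀ (γ : 𝒢 m), ∀ e ∈ E' m, γ • e ∈ E' m) ∧ y m ∈ E' m ∧
      (∀ ℓ ∈ L m, grAct (A₀ m) (traceElt (σ m ℓ) ℓ) (y m) ∈
        (E' m).map (zsmulAddGroupHom ((p ^ M : ℕ) : ℤ) : A₀ m →+ A₀ m)) ∧
      ∀ v : HeightOneSpectrum (𝓞 K), ¬ (W.baseChange K).HasGoodReductionAt v →
        ∀ x ∈ E' m, n' • pointsMap (W.baseChange K) (v.adicCompletion K) (j m x) ∈ B v) :
    ∃ cl : ℕ → galH1Torsion (W.baseChange K) ((p ^ M : ℕ) : ℤ),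
      cl 1 = kummerMapTorsion (W.baseChange K) _ hdiv P ∧
      (∀ m : ℕ, Squarefree m →
        (∀ q ∈ m.primeFactors, IsKolyvaginPrime N W K p q ∧ FrobEqFrobInfty W K (p ^ M) q) →
        conjAct W c _ (cl m) = (ε * (-1) ^ m.primeFactors.card) • cl m ∧
        (∀ v : HeightOneSpectrum (𝓞 K), (m : 𝓞 K) ∉ v.asIdeal →
          cl m ∈ selmerLocalKer (W.baseChange K) (v.adicCompletion K) ((p ^ M : ℕ) : ℤ)) ∧
        (∀ ℓ : ℕ, ℓ.Prime → ℓ ∣ m → ∀ v : HeightOneSpectrum (𝓞 K), (ℓ : 𝓞 K) ∈ v.asIdeal →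
          ∀ a : ℕ, (((p : ℤ) ^ a) • cl m ∈
              selmerLocalKer (W.baseChange K) (v.adicCompletion K) ((p ^ M : ℕ) : ℤ) ↔
            ((p : ℤ) ^ a) • cl (m / ℓ) ∈
              (W.baseChange K).torsionLocalKer (v.adicCompletion K) ((p ^ M : ℕ) : ℤ)))) := by
  refine exists_leafA_of_points (N := N) hdiv c hτ ε (fun m ↦ (j m).range) hA hAτ
    (fun m ↦ j m (kolyvaginPoint (σ m) (L m) (f m) (y m))) hPt hPt1 h541 ?_ h44
  -- `hloc`: Gross Prop. 6.2 (1) at every `v ∤ m`, by the reduction type of `E/K` at `v`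
  intro m _ _ v hv
  obtain ⟨𝔐, h𝔐⟩ := v.localPrimesAbove_nonempty
  obtain ⟨hE, hy, htr, hrec⟩ := hGZ31 m
  rcases hasGoodReductionAt_or_hasMultiplicativeReductionAt_or_hasAdditiveReductionAt v
    (W.baseChange K) with hgood | hmult | hadd
  · exact kolyvaginClass_mem_selmerLocalKer_of_inertia_of_hasGoodReductionAt (W.baseChange K) (hA m)
      (hPt m) v hgood h𝔐 (hI m v hv 𝔐 h𝔐)
  · exact kolyvaginClass_kolyvaginPoint_mem_selmerLocalKer_of_GZ31_of_hasMultiplicativeReductionAt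
      (W.baseChange K) (hf m) (hgen m) (hord m) (hdvd m) (π m) (j m) (hj m) (hA m) (hPt m) v hmult
      h𝔐 (hI m v hv 𝔐 h𝔐) (hw v) (hι v) (hC v) (B v) (hB v)
      ⟨hE, hy, htr, hrec v hmult.not_hasGoodReductionAt⟩ hcop
  · exact kolyvaginClass_kolyvaginPoint_mem_selmerLocalKer_of_GZ31_of_hasAdditiveReductionAt
      (W.baseChange K) (hf m) (hgen m) (hord m) (hdvd m) (π m) (j m) (hj m) (hA m) (hPt m) v hadd
      h𝔐 (hI m v hv 𝔐 h𝔐) (hw v) (hι v) (hC v) (B v) (hB v)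
      ⟨hE, hy, htr, hrec v hadd.not_hasGoodReductionAt⟩ hcop

/-! ### Second cut (LEAD R7-51 (R-b)): the named receptacle `E⁰(K̄_v) = X11b.E0Receptacle` -/

section E0

variable (X : WeierstrassCurve K) [X.IsElliptic] {n : ℤ}
variable {hdiv : ∀ P : geomPoints X, ∃ Q : geomPoints X, n • Q = P}
variable {𝒢 : Type*} [CommGroup 𝒢] {A₀ : Type*} [AddCommGroup A₀] [DistribMulAction 𝒢 A₀]

/-- **`hvanish` for the receptacle `E⁰(K̄_v)` at EVERY finite place** (Milne *ADT* I.3.8 for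
`𝒜° = E⁰`, all reduction types): every continuous crossed homomorphism `Γ_{K_v} → E(K̄_v)` with
values in `E⁰(K̄_v) = X11b.E0Receptacle X v` and vanishing on an inertia group `I_𝔐` has trivial
class in `H¹(K_v, E)`. By the tree trichotomy (Silverman *AEC* VII.5.1): good `v` — the tree's
`Milne2006_unramifiedClass_eq_zero_holds` (no receptacle condition); node / cusp — x11b3-p8's
`UnramifiedNode.oneCocycleClass_eq_zero_of_has{Multiplicative,Additive}ReductionAt` (p256686 /
p259017) for the CHOSEN witnesses of `X11b/NeronIdentityReceptacle` and `B := E0Receptacle X v`,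
whose `hB` is `X11b.mem_E0Receptacle_iff` (x11b3-p8's `oneCocycleClass_eq_zero_of_subset_E0`,
`UnramifiedClassAllPlaces`, is the same assembly for a parametric `B`).
[cite: SilvermanAEC2009, VII.5 Prop. 5.1] [cite: MilneADT2006, Ch. I Prop. 3.8]
[cite: GrossLMS1991, Prop. 6.2 (1), p. 244] -/
theorem oneCocycleClass_eq_zero_of_mem_E0Receptacle (v : HeightOneSpectrum (𝓞 K))
    {𝔐 : Ideal v.localAbsIntegers} (h𝔐 : 𝔐 ∈ v.localPrimesAbove)
    (f : contOneCocycles (discreteTopRep (absoluteGaloisGroup (v.adicCompletion K))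
      (localPoints X (v.adicCompletion K))))
    (hfB : ∀ τ, f.1 τ ∈ E0Receptacle X v)
    (hfI : ∀ τ ∈ 𝔐.inertia (absoluteGaloisGroup (v.adicCompletion K)), f.1 τ = 0) :
    oneCocycleClass (discreteTopRep (absoluteGaloisGroup (v.adicCompletion K))
      (localPoints X (v.adicCompletion K))) f = 0 := by
  -- the tree trichotomy (Silverman *AEC* VII.5.1): good → the tree's Milne leaf (no receptacle
  -- condition), node → `UnramifiedClassNode`, cusp → `UnramifiedClassCusp`, the latter two for the
  -- CHOSEN witnesses of `X11b/NeronIdentityReceptacle` with `hB := mem_E0Receptacle_iff`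
  rcases hasGoodReductionAt_or_hasMultiplicativeReductionAt_or_hasAdditiveReductionAt v X with
    hgood | hmult | hadd
  · exact Milne2006_unramifiedClass_eq_zero_holds X v hgood h𝔐 f hfI
  · exact oneCocycleClass_eq_zero_of_hasMultiplicativeReductionAt X
      (v.exists_spectralValuation).choose_spec hmult h𝔐
      (exists_ringHom_adicCompletionIntegers_integer (v.exists_spectralValuation).choose_spec).choose_spec
      (X.exists_variableChange_eq_localMinimalIntegralModel v).choose_spec (E0Receptacle X v)
      (fun Q hQ ↦ (mem_E0Receptacle_iff X v Q).mp hQ) f hfB hfI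
  · exact oneCocycleClass_eq_zero_of_hasAdditiveReductionAt X
      (v.exists_spectralValuation).choose_spec hadd h𝔐
      (exists_ringHom_adicCompletionIntegers_integer (v.exists_spectralValuation).choose_spec).choose_spec
      (X.exists_variableChange_eq_localMinimalIntegralModel v).choose_spec (E0Receptacle X v)
      (fun Q hQ ↦ (mem_E0Receptacle_iff X v Q).mp hQ) f hfB hfI

/-- **Gross 1991, Prop. 6.2 (1) for Kolyvagin's point `P_n` at EVERY finite place `v ∤ n`,
receptacle `E⁰(K̄_v)` by name** — x11b3-p1's END FORM (p254200) with (α) DISCHARGED by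
`oneCocycleClass_eq_zero_of_mem_E0Receptacle` and NO witness binder: inputs = the Euler-system
data, McCallum's standing inputs (`π`, `j`, `hj`, `hA`, `hP`), `hI` (inertia at `v` fixes
`jP_n`), and **`hGZ31`** ([GZ86, III (3.1)] via Gross p. 245, cite-only) whose local clause reads
`n′ • (jx)_v ∈ E⁰(K̄_v)` for `x ∈ E′`, `n′` prime to `p^M`. The flag `JET@p|N` is NOT discharged.
[cite: GrossLMS1991, Prop. 6.2 (1), pp. 244–245] [cite: GrossZagier1986, III (3.1)]
[cite: MilneADT2006, Ch. I Prop. 3.8] -/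
theorem kolyvaginClass_kolyvaginPoint_mem_selmerLocalKer_of_GZ31_E0
    {σ : ℕ → 𝒢} {L : Finset ℕ} {H : Subgroup 𝒢} [Fintype (𝒢 ⧸ H)] {f : 𝒢 ⧸ H → 𝒢}
    (hf : ∀ q, (f q : 𝒢 ⧸ H) = q) (hgen : H ≤ Subgroup.closure (σ '' (L : Set ℕ)))
    (hord : ∀ ℓ ∈ L, σ ℓ ^ (ℓ + 1) = 1) (hdvd : ∀ ℓ ∈ L, n ∣ ((ℓ + 1 : ℕ) : ℤ)) {y : A₀}
    (π : absoluteGaloisGroup K →* 𝒢) (j : A₀ →+ geomPoints X)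
    (hj : ∀ (g : absoluteGaloisGroup K) (a : A₀), j (π g • a) = g • j a)
    (hA : IsAdmissible (absoluteGaloisGroup K) j.range n)
    (hP : j (kolyvaginPoint σ L f y) ∈ invPoints (absoluteGaloisGroup K) j.range n)
    (v : HeightOneSpectrum (𝓞 K))
    {𝔐 : Ideal (v.localAbsIntegers)} (h𝔐 : 𝔐 ∈ v.localPrimesAbove)
    (hI : ∀ τ ∈ 𝔐.inertia (absoluteGaloisGroup (v.adicCompletion K)),
      resGal (K := K) (v.adicCompletion K) τ • j (kolyvaginPoint σ L f y) =
        j (kolyvaginPoint σ L f y))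
    {E' : AddSubgroup A₀} {n' : ℤ}
    (hGZ31 : (∀ (γ : 𝒢), ∀ e ∈ E', γ • e ∈ E') ∧ y ∈ E' ∧
      (∀ ℓ ∈ L, grAct A₀ (traceElt (σ ℓ) ℓ) y ∈ E'.map (zsmulAddGroupHom n : A₀ →+ A₀)) ∧
      ∀ x ∈ E', n' • pointsMap X (v.adicCompletion K) (j x) ∈ E0Receptacle X v)
    (hcop : IsCoprime n n') :
    kolyvaginClass X n hdiv hA (j (kolyvaginPoint σ L f y)) hP ∈
      selmerLocalKer X (v.adicCompletion K) n :=
  kolyvaginClass_kolyvaginPoint_mem_selmerLocalKer_of_GZ31 X hf hgen hord hdvd π j hj hA hP v hI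
    (E0Receptacle X v) hGZ31 hcop fun c hcB hcI ↦
      oneCocycleClass_eq_zero_of_mem_E0Receptacle X v h𝔐 c hcB hcI

end E0

/-- **Leaf (A) of Kolyvagin's descent from Kolyvagin's points WITHOUT `hloc`, receptacles
`E⁰(K̄_v)` by name** — `exists_leafA_of_points_of_GZ31_of_receptacle` with the per-place tree
witnesses CHOSEN (`X11b/NeronIdentityReceptacle`) and `B v := X11b.E0Receptacle (W.baseChange K) v`:
the hypotheses of the tree's `KolyvaginDescent.exists_leafA_of_points` for Kolyvagin's
`A m = (j m).range`, `Pt m = j m (kolyvaginPoint (σ m) (L m) (f m) (y m))`, with McCallum Lemma 4.3 /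
Gross Prop. 6.2 (1) at every `v ∤ m` REPLACED by `hI` (inertia), the Euler identities and
**`hGZ31`** — [GZ86, III (3.1)] as Gross 1991 p. 245 uses it, cite-only: for every `m` a
`𝒢_m`-stable `E′_m ∋ y_m` with `Tr_ℓ y_m ∈ p^M E′_m` and `n′ • (j_m x)_v ∈ E⁰(K̄_v)` for `x ∈ E′_m` at
every place `v` of bad reduction (`n′ = #E(ℚ)_tors`, prime to `p^M`). Conclusion: that of
`exists_leafA_of_points` verbatim. The Literature descent file and the named fact
`Kolyvagin1990_sha_primary_finite` are untouched; this feeds the `hpoints` hypothesis of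
`KolyvaginDescent.Kolyvagin1990_sha_primary_finite_of_pointsM_of_thmA`. The flag `JET@p|N` is NOT
discharged. [cite: GrossLMS1991, Prop. 6.2 (1), pp. 244–245, §4 (4.1), Lemma 4.3]
[cite: McCallumLMS1991, Lemma 4.3, Prop. 4.4] [cite: GrossZagier1986, III (3.1)]
[cite: MilneADT2006, Ch. I Prop. 3.8] -/
theorem exists_leafA_of_points_of_GZ31 {P : (W.baseChange K).toAffine.Point}
    {p M : ℕ} (hdiv : ∀ Q : geomPoints (W.baseChange K), ∃ R, ((p ^ M : ℕ) : ℤ) • R = Q)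
    (c : K ≃ₐ[ℚ] K) {τ : AlgebraicClosure K ≃+* AlgebraicClosure K} (hτ : IsLiftOfAut c τ)
    (ε : ℤ)
    {𝒢 : ℕ → Type*} [∀ m, CommGroup (𝒢 m)] {A₀ : ℕ → Type*} [∀ m, AddCommGroup (A₀ m)]
    [∀ m, DistribMulAction (𝒢 m) (A₀ m)]
    (σ : ∀ m, ℕ → 𝒢 m) (L : ℕ → Finset ℕ) (H : ∀ m, Subgroup (𝒢 m))
    [∀ m, Fintype (𝒢 m ⧸ H m)] (f : ∀ m, 𝒢 m ⧸ H m → 𝒢 m)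
    (hf : ∀ m q, (f m q : 𝒢 m ⧸ H m) = q)
    (hgen : ∀ m, H m ≤ Subgroup.closure (σ m '' (L m : Set ℕ)))
    (hord : ∀ m, ∀ ℓ ∈ L m, σ m ℓ ^ (ℓ + 1) = 1)
    (hdvd : ∀ m, ∀ ℓ ∈ L m, ((p ^ M : ℕ) : ℤ) ∣ ((ℓ + 1 : ℕ) : ℤ))
    (y : ∀ m, A₀ m)
    (π : ∀ m, absoluteGaloisGroup K →* 𝒢 m) (j : ∀ m, A₀ m →+ geomPoints (W.baseChange K))
    (hj : ∀ m (g : absoluteGaloisGroup K) (a : A₀ m), j m (π m g • a) = g • j m a)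
    (hA : ∀ m, IsAdmissible (absoluteGaloisGroup K) (j m).range ((p ^ M : ℕ) : ℤ))
    (hPt : ∀ m, j m (kolyvaginPoint (σ m) (L m) (f m) (y m)) ∈
      invPoints (absoluteGaloisGroup K) (j m).range ((p ^ M : ℕ) : ℤ))
    (hAτ : ∀ m, ∀ a ∈ (j m).range, hτ.pointsMap W a ∈ (j m).range)
    (hPt1 : j 1 (kolyvaginPoint (σ 1) (L 1) (f 1) (y 1)) = toGeomPoints (W.baseChange K) P)
    (h541 : ∀ m : ℕ, Squarefree m →
      (∀ q ∈ m.primeFactors, IsKolyvaginPrime N W K p q ∧ FrobEqFrobInfty W K (p ^ M) q) →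
      ∃ B ∈ (j m).range, hτ.pointsMap W (j m (kolyvaginPoint (σ m) (L m) (f m) (y m))) =
        (ε * (-1) ^ m.primeFactors.card) • j m (kolyvaginPoint (σ m) (L m) (f m) (y m)) +
          ((p ^ M : ℕ) : ℤ) • B)
    (h44 : ∀ m : ℕ, Squarefree m →
      (∀ q ∈ m.primeFactors, IsKolyvaginPrime N W K p q ∧ FrobEqFrobInfty W K (p ^ M) q) →
      ∀ ℓ : ℕ, ℓ.Prime → ℓ ∣ m → ∀ v : HeightOneSpectrum (𝓞 K), (ℓ : 𝓞 K) ∈ v.asIdeal →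
        ∀ a : ℕ, (((p : ℤ) ^ a) • kolyvaginClass (W.baseChange K) _ hdiv (hA m)
              (j m (kolyvaginPoint (σ m) (L m) (f m) (y m))) (hPt m) ∈
            selmerLocalKer (W.baseChange K) (v.adicCompletion K) ((p ^ M : ℕ) : ℤ) ↔
          ((p : ℤ) ^ a) • kolyvaginClass (W.baseChange K) _ hdiv (hA (m / ℓ))
              (j (m / ℓ) (kolyvaginPoint (σ (m / ℓ)) (L (m / ℓ)) (f (m / ℓ)) (y (m / ℓ))))
              (hPt (m / ℓ)) ∈
            (W.baseChange K).torsionLocalKer (v.adicCompletion K) ((p ^ M : ℕ) : ℤ)))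
    (hI : ∀ m : ℕ, ∀ v : HeightOneSpectrum (𝓞 K), (m : 𝓞 K) ∉ v.asIdeal →
      ∀ 𝔐 ∈ v.localPrimesAbove, ∀ t ∈ 𝔐.inertia (absoluteGaloisGroup (v.adicCompletion K)),
        resGal (K := K) (v.adicCompletion K) t • j m (kolyvaginPoint (σ m) (L m) (f m) (y m)) =
          j m (kolyvaginPoint (σ m) (L m) (f m) (y m)))
    (E' : ∀ m, AddSubgroup (A₀ m)) {n' : ℤ} (hcop : IsCoprime ((p ^ M : ℕ) : ℤ) n')
    (hGZ31 : ∀ m, (∀ (γ : 𝒢 m), ∀ e ∈ E' m, γ • e ∈ E' m) ∧ y m ∈ E' m ∧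
      (∀ ℓ ∈ L m, grAct (A₀ m) (traceElt (σ m ℓ) ℓ) (y m) ∈
        (E' m).map (zsmulAddGroupHom ((p ^ M : ℕ) : ℤ) : A₀ m →+ A₀ m)) ∧
      ∀ v : HeightOneSpectrum (𝓞 K), ¬ (W.baseChange K).HasGoodReductionAt v →
        ∀ x ∈ E' m, n' • pointsMap (W.baseChange K) (v.adicCompletion K) (j m x) ∈
          E0Receptacle (W.baseChange K) v) :
    ∃ cl : ℕ → galH1Torsion (W.baseChange K) ((p ^ M : ℕ) : ℤ),
      cl 1 = kummerMapTorsion (W.baseChange K) _ hdiv P ∧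
      (∀ m : ℕ, Squarefree m →
        (∀ q ∈ m.primeFactors, IsKolyvaginPrime N W K p q ∧ FrobEqFrobInfty W K (p ^ M) q) →
        conjAct W c _ (cl m) = (ε * (-1) ^ m.primeFactors.card) • cl m ∧
        (∀ v : HeightOneSpectrum (𝓞 K), (m : 𝓞 K) ∉ v.asIdeal →
          cl m ∈ selmerLocalKer (W.baseChange K) (v.adicCompletion K) ((p ^ M : ℕ) : ℤ)) ∧
        (∀ ℓ : ℕ, ℓ.Prime → ℓ ∣ m → ∀ v : HeightOneSpectrum (𝓞 K), (ℓ : 𝓞 K) ∈ v.asIdeal →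
          ∀ a : ℕ, (((p : ℤ) ^ a) • cl m ∈
              selmerLocalKer (W.baseChange K) (v.adicCompletion K) ((p ^ M : ℕ) : ℤ) ↔
            ((p : ℤ) ^ a) • cl (m / ℓ) ∈
              (W.baseChange K).torsionLocalKer (v.adicCompletion K) ((p ^ M : ℕ) : ℤ)))) :=
  exists_leafA_of_points_of_GZ31_of_receptacle (N := N) hdiv c hτ ε σ L H f hf hgen hord hdvd y π j
    hj hA hPt hAτ hPt1 h541 h44 hI
    (fun v ↦ (v.exists_spectralValuation).choose) (fun v ↦ (v.exists_spectralValuation).choose_spec)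
    (fun v ↦ (exists_ringHom_adicCompletionIntegers_integer
      (v.exists_spectralValuation).choose_spec).choose)
    (fun v ↦ (exists_ringHom_adicCompletionIntegers_integer
      (v.exists_spectralValuation).choose_spec).choose_spec)
    (fun v ↦ ((W.baseChange K).exists_variableChange_eq_localMinimalIntegralModel v).choose)
    (fun v ↦ ((W.baseChange K).exists_variableChange_eq_localMinimalIntegralModel v).choose_spec)
    (fun v ↦ E0Receptacle (W.baseChange K) v)
    (fun v Q hQ ↦ (mem_E0Receptacle_iff (W.baseChange K) v Q).mp hQ) E' hcop hGZ31

end Summit.BirchSwinnertonDyer.Rank1Residual.X11b.Three.GrossBadPlace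

end
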